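import Summits.CriticalPhenomena.PercolationContinuityZ3.Theorems.PercNearOneGluingNoHeavyLowerTailMajorityGluingTypeTableScaledStarConst
import HarnessLib

/-!
# Template S in the kernel: every checked row holds, the objective bounds, and the three closing arguments
(lane prim-rate, constants-miner 1, gen 30; RIGOROUS-CERTIFICATION.md §4 (the bounds of THEOREM BOTTOM-3); KERNEL-WINDOW.md §0 (5))

Support file for the closed crux `NoHeavyLowerTail` (stmt-CriticalPhenomena-4575), majority-gluing line; continuation of
`…TypeTableScaledStarConst`.  (1) `srow_valid`: every non-box row accepted by `SRow.ok` holds for the (restricted) scaled law of a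
case law — so `checkS` bounds the objective's factor part (`objective_le`).  (2) The AM–GM conversions: `Π_z(Ŝ_z+T̂_z) ≤ W⁴`
(world A), `Π_{z≠w}(Ŝ_z+T̂_z) ≤ W³` (world B), `ρ̂_aρ̂_bρ̂_c ≤ W³` (all-top), `W = V/N_obj`.  (3) The CLOSING ARGUMENTS as pure real
lemmas (`closeA_real`, `closeB_real`, `close8_real`): from `3E ≤ U₄`, ISO₄, the scaled product bound and the rational closing check,
`E ≤ M` for EVERY `M ≤ M_top` (the `μ`-free exponent inequalities `2c₄ − 4 ≤ 4s₀`, `≤ 3s₀`, `2 − 3q₃ ≤ 3q₃s₀`).  The assembly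
per case (`case_sound`) and the cover are in `…TypeTableScaledCase`.  No percolation, no sorries.
[cite: VandenbergHaggstromKahn2005, Thm. 1.3 (p. 6)]
-/

namespace Summit.CriticalPhenomena.PercolationContinuityZ3.Theorems

namespace HubOnly
namespace TypeTable

open DType

noncomputable section

variable {K : ℕ} {M : ℝ} {x : DType → ℝ} {cs : SCase}

/-! ### Every checked row holds -/

/-- **Row validity for template S.**  Every non-box row accepted by `SRow.ok K cs rs` holds for the scaled law `xs rs` of a case law. -/
theorem srow_valid (L : SLaw K cs M x) {rs : Bool} (row : SRow) (hok : row.ok K cs rs = true) (hnb : row.isBox = false) :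
    lin ((row.toRow cs).φ) (xs rs K M cs.w x) ≤ (((row.toRow cs).b : ℚ) : ℝ) := by
  cases row with
  | tan r => exact tan_valid L r hok
  | star z t i N G H => exact star_valid L hok
  | starB z t i N G H => exact starB_valid L hok
  | box n B => simp [SRow.isBox] at hnb
  | lin i => exact static_valid L _ rfl hok
  | erow => exact static_valid L _ rfl hok
  | dom z => exact static_valid L _ rfl hok
  | bandhi z => exact static_valid L _ rfl hok
  | bandlo z => exact static_valid L _ rfl hok
  | junkE z => exact static_valid L _ rfl hok
  | junk0 z => exact static_valid L _ rfl hok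
  | ctrlE z => exact static_valid L _ rfl hok
  | ctrl0 z => exact static_valid L _ rfl hok
  | relay z y => exact static_valid L _ rfl hok

/-- **The objective bound of a passing certificate**: `objFac ≤ V` for the scaled law of every case law. -/
theorem objective_le (L : SLaw K cs M x) {W : SWorld} {c : SCert} (h : checkS K cs W c = true) :
    objFac cs W c.obj (xs W.restricted K M cs.w x) ≤ (c.V : ℝ) := by
  obtain ⟨hnn, hsupp⟩ := xs_nonneg_supp W.restricted cs.w L.nonneg L.Mpos L.Mle (K := K)
  have hok : ∀ r ∈ c.rows, SRow.ok K cs W.restricted r = true := by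
    unfold checkS at h; simp only [Bool.and_eq_true, List.all_eq_true] at h
    exact h.1.1.1.1.1.1.2
  exact checkS_objective_le h _ hnn hsupp (fun r hr hnb => srow_valid L r (hok r hr) hnb)

/-! ### AM–GM: from the objective bound to product bounds -/

/-- Weighted AM–GM for four factors with integer weights dominating `N^4`. -/
theorem amgm4_weighted {a b c d : ℝ} {g1 g2 g3 g4 N : ℕ} (ha : 0 ≤ a) (hb : 0 ≤ b) (hc : 0 ≤ c) (hd : 0 ≤ d) (hN : 0 < N)
    (hg : (N : ℝ) ^ 4 ≤ (4 * g1) * ((4 * g2) * ((4 * g3) * (4 * g4)))) :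
    a * b * c * d ≤ ((g1 * a + g2 * b + g3 * c + g4 * d) / N) ^ 4 := by
  have hN' : (0 : ℝ) < N := by exact_mod_cast hN
  have h := amgm4 (a := 4 * g1 * a / N) (b := 4 * g2 * b / N) (c := 4 * g3 * c / N) (d := 4 * g4 * d / N)
    (by positivity) (by positivity) (by positivity) (by positivity)
  have e : (4 * g1 * a / N + 4 * g2 * b / N + 4 * g3 * c / N + 4 * g4 * d / N) / 4 = (g1 * a + g2 * b + g3 * c + g4 * d) / N := by
    field_simp
  rw [e] at h
  have habcd : 0 ≤ a * b * c * d := by positivity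
  have e2 : 4 * g1 * a / N * (4 * g2 * b / N) * (4 * g3 * c / N) * (4 * g4 * d / N) =
      ((4 * g1) * ((4 * g2) * ((4 * g3) * (4 * g4))) / (N : ℝ) ^ 4) * (a * b * c * d) := by
    field_simp
  rw [e2] at h
  have hge : 1 ≤ (4 * g1) * ((4 * g2) * ((4 * g3) * (4 * g4))) / (N : ℝ) ^ 4 := by
    rw [le_div_iff₀ (by positivity)]; linarith
  nlinarith

/-- Weighted AM–GM for three factors with integer weights dominating `N^3`. -/
theorem amgm3_weighted {a b c : ℝ} {g1 g2 g3 N : ℕ} (ha : 0 ≤ a) (hb : 0 ≤ b) (hc : 0 ≤ c) (hN : 0 < N)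
    (hg : (N : ℝ) ^ 3 ≤ (3 * g1) * ((3 * g2) * (3 * g3))) :
    a * b * c ≤ ((g1 * a + g2 * b + g3 * c) / N) ^ 3 := by
  have hN' : (0 : ℝ) < N := by exact_mod_cast hN
  have h := amgm3 (a := 3 * g1 * a / N) (b := 3 * g2 * b / N) (c := 3 * g3 * c / N)
    (by positivity) (by positivity) (by positivity)
  have e : (3 * g1 * a / N + 3 * g2 * b / N + 3 * g3 * c / N) / 3 = (g1 * a + g2 * b + g3 * c) / N := by
    field_simp
  rw [e] at h
  have habc : 0 ≤ a * b * c := by positivity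
  have e2 : 3 * g1 * a / N * (3 * g2 * b / N) * (3 * g3 * c / N) =
      ((3 * g1) * ((3 * g2) * (3 * g3)) / (N : ℝ) ^ 3) * (a * b * c) := by
    field_simp
  rw [e2] at h
  have hge : 1 ≤ (3 * g1) * ((3 * g2) * (3 * g3)) / (N : ℝ) ^ 3 := by
    rw [le_div_iff₀ (by positivity)]; linarith
  nlinarith

/-- `lin (stφ z) y = S_z(y) + T_z(y)`. -/
theorem lin_st (z : ℕ) (y : DType → ℝ) : lin (stφ z) y = Sm z y + Tm z y := by
  have h := lin_combo [(1, fun τ => ind (τ.isS z)), (1, fun τ => ind (τ.isT z))] y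
  simp only [List.map_cons, List.map_nil, List.sum_cons, List.sum_nil, add_zero, Int.cast_one, one_mul] at h
  rw [← h]; exact lin_congr (fun τ _ => by simp [combo, stφ]) y

/-- **World A**: the objective check and `objFac ≤ V` give `Π_z (S_z + T_z)(y) ≤ (V/N_obj)^4`. -/
theorem prodA_le {o : SObj} {y : DType → ℝ} (hy : ∀ τ, 0 ≤ y τ) (hok : o.ok .A = true) {V : ℚ}
    (h : objFac cs .A o y ≤ (V : ℝ)) :
    (Sm 1 y + Tm 1 y) * (Sm 2 y + Tm 2 y) * (Sm 3 y + Tm 3 y) * (Sm 4 y + Tm 4 y) ≤ ((V : ℝ) / NOBJ) ^ 4 := by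
  simp only [SObj.ok, SWorld.nfac, Bool.and_eq_true, decide_eq_true_eq] at hok
  obtain ⟨⟨hlen, hE⟩, hprod⟩ := hok
  obtain ⟨gs, E1⟩ := o
  match gs, hlen with
  | [g1, g2, g3, g4], _ =>
    simp only [objFac, SWorld.zs, SWorld.facφ, List.zip_cons_cons, List.zip_nil_right, List.map_cons, List.map_nil,
      List.sum_cons, List.sum_nil, add_zero, lin_st] at h
    simp only [List.map_cons, List.map_nil, List.prod_cons, List.prod_nil, mul_one] at hprod
    have s1 : 0 ≤ Sm 1 y + Tm 1 y := add_nonneg (lin_ind_nonneg _ hy) (lin_ind_nonneg _ hy)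
    have s2 : 0 ≤ Sm 2 y + Tm 2 y := add_nonneg (lin_ind_nonneg _ hy) (lin_ind_nonneg _ hy)
    have s3 : 0 ≤ Sm 3 y + Tm 3 y := add_nonneg (lin_ind_nonneg _ hy) (lin_ind_nonneg _ hy)
    have s4 : 0 ≤ Sm 4 y + Tm 4 y := add_nonneg (lin_ind_nonneg _ hy) (lin_ind_nonneg _ hy)
    have hg : ((NOBJ : ℕ) : ℝ) ^ 4 ≤ (4 * g1) * ((4 * g2) * ((4 * g3) * (4 * g4))) := by exact_mod_cast hprod
    have ham := amgm4_weighted s1 s2 s3 s4 (by decide) hg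
    refine le_trans (le_of_eq (by ring)) (ham.trans ?_)
    have h0 : 0 ≤ (g1 * (Sm 1 y + Tm 1 y) + g2 * (Sm 2 y + Tm 2 y) + g3 * (Sm 3 y + Tm 3 y) + g4 * (Sm 4 y + Tm 4 y)) / (NOBJ : ℕ) := by
      positivity
    exact pow_le_pow_left₀ h0 (div_le_div_of_nonneg_right (by linarith) (by positivity)) 4

/-- The other three relays of a relay `w`, and the regrouping of the four-fold product around `w`. -/
theorem othersOf_spec {w : ℕ} (hw : w ∈ [1, 2, 3, 4]) (st : ℕ → ℝ) :
    ∃ a b d : ℕ, othersOf w = [a, b, d] ∧ a ∈ [1, 2, 3, 4] ∧ b ∈ [1, 2, 3, 4] ∧ d ∈ [1, 2, 3, 4] ∧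
      a ≠ w ∧ b ≠ w ∧ d ≠ w ∧ st 1 * st 2 * st 3 * st 4 = st w * (st a * st b * st d) := by
  simp only [List.mem_cons, List.not_mem_nil, or_false] at hw
  rcases hw with rfl | rfl | rfl | rfl
  · exact ⟨2, 3, 4, rfl, by simp, by simp, by simp, by omega, by omega, by omega, by ring⟩
  · exact ⟨1, 3, 4, rfl, by simp, by simp, by simp, by omega, by omega, by omega, by ring⟩
  · exact ⟨1, 2, 4, rfl, by simp, by simp, by simp, by omega, by omega, by omega, by ring⟩
  · exact ⟨1, 2, 3, rfl, by simp, by simp, by simp, by omega, by omega, by omega, by ring⟩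

/-- **World B**: `Π_{z≠w} (S_z + T_z)(y) ≤ (V/N_obj)^3` over the three relays `othersOf w`. -/
theorem prodB_le {o : SObj} {y : DType → ℝ} (hy : ∀ τ, 0 ≤ y τ) (hw : cs.w ∈ [1, 2, 3, 4]) (hok : o.ok .B = true) {V : ℚ}
    (h : objFac cs .B o y ≤ (V : ℝ)) :
    ∃ a b d : ℕ, othersOf cs.w = [a, b, d] ∧
      (Sm a y + Tm a y) * (Sm b y + Tm b y) * (Sm d y + Tm d y) ≤ ((V : ℝ) / NOBJ) ^ 3 := by
  simp only [SObj.ok, SWorld.nfac, Bool.and_eq_true, decide_eq_true_eq] at hok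
  obtain ⟨⟨hlen, hE⟩, hprod⟩ := hok
  obtain ⟨gs, E1⟩ := o
  obtain ⟨a, b, d, e, ha, hb, hd, -, -, -, -⟩ := othersOf_spec hw (fun z => Sm z y + Tm z y)
  have sa : 0 ≤ Sm a y + Tm a y := add_nonneg (lin_ind_nonneg _ hy) (lin_ind_nonneg _ hy)
  have sb : 0 ≤ Sm b y + Tm b y := add_nonneg (lin_ind_nonneg _ hy) (lin_ind_nonneg _ hy)
  have sd : 0 ≤ Sm d y + Tm d y := add_nonneg (lin_ind_nonneg _ hy) (lin_ind_nonneg _ hy)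
  match gs, hlen with
  | [g1, g2, g3], _ =>
    simp only [objFac, SWorld.zs, e, SWorld.facφ, List.zip_cons_cons, List.zip_nil_right, List.map_cons, List.map_nil,
      List.sum_cons, List.sum_nil, add_zero, lin_st] at h
    simp only [List.map_cons, List.map_nil, List.prod_cons, List.prod_nil, mul_one] at hprod
    have hg : ((NOBJ : ℕ) : ℝ) ^ 3 ≤ (3 * g1) * ((3 * g2) * (3 * g3)) := by exact_mod_cast hprod
    refine ⟨a, b, d, e, ?_⟩
    exact (amgm3_weighted sa sb sd (by decide) hg).trans (pow_le_pow_left₀ (by positivity)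
      (div_le_div_of_nonneg_right (by linarith) (by positivity)) 3)

/-- **All-top**: `ρ_a ρ_b ρ_c (y) ≤ (V/N_obj)^3` for the relay triple `S = [a, b, c]` of the objective. -/
theorem prodTop_le {o : SObj} {y : DType → ℝ} (hy : ∀ τ, 0 ≤ y τ) {a b d : ℕ} (hok : o.ok (.top [a, b, d]) = true)
    {V : ℚ} (h : objFac cs (.top [a, b, d]) o y ≤ (V : ℝ)) :
    lin (fun τ => ind (τ.rho [a, b, d] a)) y * lin (fun τ => ind (τ.rho [a, b, d] b)) y *
      lin (fun τ => ind (τ.rho [a, b, d] d)) y ≤ ((V : ℝ) / NOBJ) ^ 3 := by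
  simp only [SObj.ok, SWorld.nfac, Bool.and_eq_true, decide_eq_true_eq] at hok
  obtain ⟨⟨hlen, hE⟩, hprod⟩ := hok
  obtain ⟨gs, E1⟩ := o
  match gs, hlen with
  | [g1, g2, g3], _ =>
    simp only [objFac, SWorld.zs, SWorld.facφ, List.zip_cons_cons, List.zip_nil_right, List.map_cons,
      List.map_nil, List.sum_cons, List.sum_nil, add_zero] at h
    simp only [List.map_cons, List.map_nil, List.prod_cons, List.prod_nil, mul_one] at hprod
    have hg : ((NOBJ : ℕ) : ℝ) ^ 3 ≤ (3 * g1) * ((3 * g2) * (3 * g3)) := by exact_mod_cast hprod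
    have r1 := lin_ind_nonneg (fun τ => τ.rho [a, b, d] a) hy
    have r2 := lin_ind_nonneg (fun τ => τ.rho [a, b, d] b) hy
    have r3 := lin_ind_nonneg (fun τ => τ.rho [a, b, d] d) hy
    have h0 : 0 ≤ ((g1 : ℝ) * lin (fun τ => ind (τ.rho [a, b, d] a)) y + g2 * lin (fun τ => ind (τ.rho [a, b, d] b)) y +
        g3 * lin (fun τ => ind (τ.rho [a, b, d] d)) y) / (NOBJ : ℕ) := by positivity
    exact (amgm3_weighted r1 r2 r3 (by decide) hg).trans
      (pow_le_pow_left₀ h0 (div_le_div_of_nonneg_right (by linarith) (by positivity)) 3)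

end

end TypeTable
end HubOnly

end Summit.CriticalPhenomena.PercolationContinuityZ3.Theorems
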